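import Summits.QuantumFields.BalabanUV.Beta.GAN24.DerivativeRateTransferJensenMassFreeLocal
import Summits.QuantumFields.BalabanUV.Beta.GAN24.DerivativeRateTransferJensenMassFreePolarFactor

/-!
# `BalabanUV.Beta.GAN24.DerivativeRateTransferJensenMassFreeLocalEnd` — binder row G-an2-4 ∕ (CONV-C), route R6 «VALUES, NOT DERIVATIVES», PART 62:
# THE SUPPORT-LOCAL POLAR ENDs — PART 53's `δ = 0` END, PART 57's loop form and PART 58's convention-free form RE-TYPED with the pointwise letters
# (`hN`, the closed-loop letter) asked only at sites of positive block weight; these are the forms the lattice instance can discharge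
# (unit b2b-balaban-gan24-p3, gen 44; v1)

NOT IN PRINT; OUR PROOF (for the ROUTE; [folklore] — PART 53 ∕ 57 ∕ 58's proofs verbatim over PART 61's local lemmas; PART 57's abstract `rootDefect_le_two_spread`
applied to the family EXTENDED off the support by a support value).  HONEST FRAMING (cell contract, verbatim): «discharging `BetaPertH` makes Bałaban's UV
stability UNCONDITIONAL — a real constructive-QFT result; it is NOT the continuum limit and NOT the Clay problem.»  HONEST DEPENDENCY (verbatim): «continuum
YM on T⁴ ⇐ BetaPertH ∧ nine spine estimates (0/9 proved); BetaPertH ⇐ (D1) ∧ (D4) ∧ CAP+tail; G-an2-4 gates asym, D1 and NE2/3/4.»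

WHY THIS FILE.  See PART 61: the global pointwise letters of PARTs 53 ∕ 57 ∕ 58 are not dischargeable off the block on the lattice; here are the
support-local ENDs.  (§1) **`sum_coarseDiff_sq_le_polar_local`**, **`covJensen_polar_massFree_local`** = PART 53's END with
`hN : q(src′e′,x) ≠ 0 → |N(e′,x)w|² ≤ κ²|w|²`; (§2) **`rootDefect_le_of_polar_loops_local`**: the polar letters `hsym` ∕ `hPpsd` + the closed-loop letter ON
THE SUPPORT (`q(src′e′,x) ≠ 0 → q(src′e′,x′) ≠ 0 → |(τ_xᵀτ_{x′} − 1)w|² ≤ D²|w|²`) ⟹ `hN` on the support with `κ = 2D` (PART 57 `rootDefect_le_two_spread`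
on the family extended by a support value off the support); (§3) **`covJensen_polar_massFree_of_loops_local`** (PART 57's END, local) and
**`exists_polarLink_covJensen_massFree_local`** (PART 58's convention-free END, local: from the fine data and the local loop letter alone, ∃ orthogonal
polar links with the `δ = 0` inequality for every compatible coarse form).  PART 63 instantiates the last one on PART 24's lattice with PART 60's
`D = 2d(L−1)·L·p̂`.

WHAT THIS FILE PROVES (0 sorry, 0 `def`, nothing cited): §1 **`sum_coarseDiff_sq_le_polar_local`**, **`covJensen_polar_massFree_local`**; §2
`spread_extend`, **`rootDefect_le_of_polar_loops_local`**; §3 **`covJensen_polar_massFree_of_loops_local`**, **`exists_polarLink_covJensen_massFree_local`**.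
WHAT IT DOES NOT DO: change PARTs 53 ∕ 57 ∕ 58, instantiate anything of Bałaban's, or claim (CONS) ∕ exact (STAB).  SUPPLIER work on route R6 (rank 2,
REDUCTION, no seat); no consumer of record; NEVER «G-an2-4 closed»; NOT (CONV-C), NOT D1, NOT `BetaPertH`, NOT continuum, NOT Clay.
Records: `HOME/b2b-balaban-gan24-p3/WOODBURY-FIBRE.md` v14.4. -/

noncomputable section

open Matrix Finset

namespace Summit.QuantumFields.BalabanUV.Beta.GAN24.DerivativeRateTransferJensenMassFreeLocalEnd

open Summit.QuantumFields.BalabanUV.Beta.GAN24.DerivativeRateTransferLoewnerKKT (mulVec_dotProduct_eq)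
open Summit.QuantumFields.BalabanUV.Beta.GAN24.DerivativeRateTransferJensenChain
open Summit.QuantumFields.BalabanUV.Beta.GAN24.DerivativeRateTransferJensen
open Summit.QuantumFields.BalabanUV.Beta.GAN24.DerivativeRateTransferJensenMeanZero
open Summit.QuantumFields.BalabanUV.Beta.GAN24.DerivativeRateTransferJensenMassFree
open Summit.QuantumFields.BalabanUV.Beta.GAN24.DerivativeRateTransferJensenMassFreeEnd
open Summit.QuantumFields.BalabanUV.Beta.GAN24.DerivativeRateTransferJensenMassFreeSpread
open Summit.QuantumFields.BalabanUV.Beta.GAN24.DerivativeRateTransferJensenMassFreePolarFactor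
open Summit.QuantumFields.BalabanUV.Beta.GAN24.DerivativeRateTransferJensenMassFreeLocal

/-! ## §1 PART 53's `δ = 0` END with the support-local defect letter -/

section End

variable {o μ ν β β' : Type*} [Fintype o] [DecidableEq o] [Fintype μ] [Fintype ν] [Fintype β] [DecidableEq β] [Fintype β']
variable {q : μ → ν → ℝ} {W : μ → ν → Matrix o o ℝ} {Q : Matrix (μ × o) (ν × o) ℝ}
variable {src tgt : β → ν} {R : β → Matrix o o ℝ} {src' tgt' : β' → μ} {R' : β' → Matrix o o ℝ}
variable {Hf : Matrix (ν × o) (ν × o) ℝ} {Hc : Matrix (μ × o) (μ × o) ℝ} {wf wc : ℝ}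
variable {σ : β' → ν ≃ ν} {ℓ : ℕ} {xs : β' → ν → ℕ → ν} {γ : β' → ν → ℕ → β} {T : β' → ν → ℕ → Matrix o o ℝ} {m : ℝ}
variable {N : β' → ν → Matrix o o ℝ} {Φ : (ν × o → ℝ) → μ → ℝ} {ϖ ϖ' κ : ℝ}

omit [Fintype μ] in
/-- **`sum_coarseDiff_sq_le_polar_local` — PART 53's COARSE BOND ENERGY BOUND, POLAR PAIR, SUPPORT-LOCAL DEFECT LETTER** [our proof; PART 53's proof
verbatim over PART 61's local bound and local polar datum].  PART 47's letters
(block weights `q ≥ 0` with `Σ_x q(y,x) = 1`, orthogonal `W, R, R′`, averaging identity `hQ`, fine form bound `hHf`, pairings `σ`, straight chains of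
length `ℓ` with q-weighted multiplicity `≤ m`, `w_c·ℓ·m ≤ w_f`, root-frame defects `N` with `|Nw|² ≤ κ²|w|²`), the Poincaré datum `hP` with budgets at
BOTH ends of the coarse bonds (`w_cΣ_{e′}Φ(tgt′e′) ≤ ϖ⟨u,H_fu⟩`, `w_cΣ_{e′}Φ(src′e′) ≤ ϖ′⟨u,H_fu⟩`), the POLAR letter «`Σ_x q(src′e′,x)·N(e′,x)` symmetric»
and `κ² < 4` ⟹ for all `t, r > 0`:
`w_c·Σ_{e′}|R′_{e′}(Qu)(tgt′e′) − (Qu)(src′e′)|² ≤ (1 + t + (1+t⁻¹)(1+r)ϖκ² + (1+t⁻¹)(1+r⁻¹)·(3κ²∕(4 − κ²))·(1 + ϖ + ϖ′))·⟨u, H_f u⟩`. -/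
theorem sum_coarseDiff_sq_le_polar_local
    (hq : ∀ y x, 0 ≤ q y x) (hq1 : ∀ y, ∑ x, q y x = 1) (hW : ∀ y x, (W y x)ᵀ * W y x = 1) (hR : ∀ e, (R e)ᵀ * R e = 1)
    (hR' : ∀ e', (R' e')ᵀ * R' e' = 1)
    (hQ : ∀ (u : ν × o → ℝ) (y : μ), (fun a => (Q *ᵥ u) (y, a)) = ∑ x, q y x • (W y x *ᵥ fun b => u (x, b)))
    (hwc : 0 ≤ wc)
    (hHf : ∀ u : ν × o → ℝ, wf * ∑ e, ((R e *ᵥ fun b => u (tgt e, b)) - fun b => u (src e, b)) ⬝ᵥ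
        ((R e *ᵥ fun b => u (tgt e, b)) - fun b => u (src e, b)) ≤ u ⬝ᵥ (Hf *ᵥ u))
    (hσq : ∀ e' x, q (tgt' e') (σ e' x) = q (src' e') x)
    (hx0 : ∀ e' x, xs e' x 0 = x) (hxℓ : ∀ e' x, xs e' x ℓ = σ e' x)
    (hsrc : ∀ e' x i, i < ℓ → src (γ e' x i) = xs e' x i) (htgt : ∀ e' x i, i < ℓ → tgt (γ e' x i) = xs e' x (i + 1))
    (hT0 : ∀ e' x, T e' x 0 = 1) (hT : ∀ e' x i, i < ℓ → T e' x (i + 1) = T e' x i * R (γ e' x i))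
    (hmult : ∀ e, ∑ e', ∑ x, ∑ i ∈ range ℓ, (if γ e' x i = e then q (src' e') x else 0) ≤ m)
    (hw : wc * ℓ * m ≤ wf)
    (hNdef : ∀ e' x, N e' x = 1 - W (src' e') x * T e' x ℓ * (W (tgt' e') (σ e' x))ᵀ * (R' e')ᵀ)
    (hN : ∀ e' x, q (src' e') x ≠ 0 → ∀ w : o → ℝ, (N e' x *ᵥ w) ⬝ᵥ (N e' x *ᵥ w) ≤ κ ^ 2 * (w ⬝ᵥ w))
    (hsym : ∀ e', (∑ x, q (src' e') x • N e' x)ᵀ = ∑ x, q (src' e') x • N e' x) (hκ : κ ^ 2 < 4)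
    (u : ν × o → ℝ)
    (hP : ∀ y, ∑ x, q y x * (((W y x *ᵥ fun b => u (x, b)) - fun a => (Q *ᵥ u) (y, a)) ⬝ᵥ
        ((W y x *ᵥ fun b => u (x, b)) - fun a => (Q *ᵥ u) (y, a))) ≤ Φ u y)
    (hΦ : wc * ∑ e', Φ u (tgt' e') ≤ ϖ * (u ⬝ᵥ (Hf *ᵥ u))) (hΦ' : wc * ∑ e', Φ u (src' e') ≤ ϖ' * (u ⬝ᵥ (Hf *ᵥ u)))
    {t r : ℝ} (ht : 0 < t) (hr : 0 < r) :
    wc * ∑ e', ((R' e' *ᵥ fun a => (Q *ᵥ u) (tgt' e', a)) - fun a => (Q *ᵥ u) (src' e', a)) ⬝ᵥ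
        ((R' e' *ᵥ fun a => (Q *ᵥ u) (tgt' e', a)) - fun a => (Q *ᵥ u) (src' e', a)) ≤
      (1 + t + (1 + t⁻¹) * (1 + r) * ϖ * κ ^ 2 + (1 + t⁻¹) * (1 + r⁻¹) * (3 * κ ^ 2 / (4 - κ ^ 2)) * (1 + ϖ + ϖ')) *
        (u ⬝ᵥ (Hf *ᵥ u)) := by
  -- the fine bond energies and the three per-bond sums of the polar mass datum
  set F : β → ℝ := fun e => ((R e *ᵥ fun b => u (tgt e, b)) - fun b => u (src e, b)) ⬝ᵥ
    ((R e *ᵥ fun b => u (tgt e, b)) - fun b => u (src e, b)) with hF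
  set P : μ → ℝ := fun y => ∑ x, q y x * (((W y x *ᵥ fun b => u (x, b)) - fun a => (Q *ᵥ u) (y, a)) ⬝ᵥ
    ((W y x *ᵥ fun b => u (x, b)) - fun a => (Q *ᵥ u) (y, a))) with hPdef
  set C : β' → ℝ := fun e' => ∑ x, q (src' e') x * ∑ i ∈ range ℓ, F (γ e' x i) with hCdef
  have hF0 : ∀ e, 0 ≤ F e := fun e => dotProduct_self_nonneg' _
  have hSF : 0 ≤ ∑ e, F e := Finset.sum_nonneg fun e _ => hF0 e
  have h4 : 0 < 4 - κ ^ 2 := by linarith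
  have hcoef : 0 ≤ 3 * κ ^ 2 / (4 - κ ^ 2) := by positivity
  -- the polar mass datum per bond
  have hS : ∀ e', ((∑ x, q (src' e') x • N e' x) *ᵥ (R' e' *ᵥ fun a => (Q *ᵥ u) (tgt' e', a))) ⬝ᵥ
      ((∑ x, q (src' e') x • N e' x) *ᵥ (R' e' *ᵥ fun a => (Q *ᵥ u) (tgt' e', a))) ≤
        3 * κ ^ 2 / (4 - κ ^ 2) * (P (tgt' e') + ℓ * C e' + P (src' e')) := fun e' =>
    massDatum_polar_le_local hq hq1 hW hR hR' hσq hx0 hxℓ hsrc htgt hT0 hT hNdef hN hsym hκ u e'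
  -- its budget: `w_c·Σ_{e′}(P(tgt′) + ℓ·C + P(src′)) ≤ (ϖ + 1 + ϖ′)·⟨u,H_fu⟩`
  have hPΦ : ∀ y, P y ≤ Φ u y := fun y => hP y
  have hbud : wc * ∑ e', 3 * κ ^ 2 / (4 - κ ^ 2) * (P (tgt' e') + ℓ * C e' + P (src' e')) ≤
      3 * κ ^ 2 / (4 - κ ^ 2) * (1 + ϖ + ϖ') * (u ⬝ᵥ (Hf *ᵥ u)) := by
    have e1 : wc * ∑ e', 3 * κ ^ 2 / (4 - κ ^ 2) * (P (tgt' e') + ℓ * C e' + P (src' e')) =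
        3 * κ ^ 2 / (4 - κ ^ 2) * (wc * ∑ e', P (tgt' e') + wc * (ℓ * ∑ e', C e') + wc * ∑ e', P (src' e')) := by
      rw [← Finset.mul_sum, Finset.sum_add_distrib, Finset.sum_add_distrib, ← Finset.mul_sum]; ring
    rw [e1]
    have a1 : wc * ∑ e', P (tgt' e') ≤ ϖ * (u ⬝ᵥ (Hf *ᵥ u)) :=
      (mul_le_mul_of_nonneg_left (Finset.sum_le_sum fun e' _ => hPΦ (tgt' e')) hwc).trans hΦ
    have a2 : wc * ∑ e', P (src' e') ≤ ϖ' * (u ⬝ᵥ (Hf *ᵥ u)) :=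
      (mul_le_mul_of_nonneg_left (Finset.sum_le_sum fun e' _ => hPΦ (src' e')) hwc).trans hΦ'
    have a3 : wc * (ℓ * ∑ e', C e') ≤ u ⬝ᵥ (Hf *ᵥ u) := by
      have hmu := sum_chain_le_of_multiplicity q src' γ ℓ hmult F hF0
      calc wc * (ℓ * ∑ e', C e') ≤ wc * (ℓ * (m * ∑ e, F e)) :=
            mul_le_mul_of_nonneg_left (mul_le_mul_of_nonneg_left hmu (Nat.cast_nonneg _)) hwc
        _ = (wc * ℓ * m) * ∑ e, F e := by ring
        _ ≤ wf * ∑ e, F e := mul_le_mul_of_nonneg_right hw hSF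
        _ ≤ u ⬝ᵥ (Hf *ᵥ u) := hHf u
    have : wc * ∑ e', P (tgt' e') + wc * (ℓ * ∑ e', C e') + wc * ∑ e', P (src' e') ≤ (1 + ϖ + ϖ') * (u ⬝ᵥ (Hf *ᵥ u)) := by
      linarith
    calc 3 * κ ^ 2 / (4 - κ ^ 2) * (wc * ∑ e', P (tgt' e') + wc * (ℓ * ∑ e', C e') + wc * ∑ e', P (src' e'))
        ≤ 3 * κ ^ 2 / (4 - κ ^ 2) * ((1 + ϖ + ϖ') * (u ⬝ᵥ (Hf *ᵥ u))) := mul_le_mul_of_nonneg_left this hcoef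
      _ = 3 * κ ^ 2 / (4 - κ ^ 2) * (1 + ϖ + ϖ') * (u ⬝ᵥ (Hf *ᵥ u)) := by ring
  have h := sum_coarseDiff_sq_le_massDatum_local hq (fun y => (hq1 y).le) hW hR hR' hQ hwc hHf hσq hx0 hxℓ hsrc htgt hT0 hT hmult hw hNdef hN u
    hP hΦ
    (Ψ := fun e' => 3 * κ ^ 2 / (4 - κ ^ 2) * (P (tgt' e') + ℓ * C e' + P (src' e'))) hS hbud ht hr
  refine h.trans (le_of_eq ?_)
  ring

/-- **`covJensen_polar_massFree_local` — THE MASS-FREE COVARIANT JENSEN INEQUALITY FOR THE POLAR PAIR, SUPPORT-LOCAL DEFECT LETTER** [our proof]: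
`sum_coarseDiff_sq_le_polar_local` with a
coarse form `H_c ≤ w_c·Σ_{e′}|R′_{e′}v(tgt′e′) − v(src′e′)|²` ⟹ for all `t, r > 0`:
`⟨Qu, H_cQu⟩ ≤ (1 + t + (1+t⁻¹)(1+r)ϖκ² + (1+t⁻¹)(1+r⁻¹)·(3κ²∕(4 − κ²))·(1 + ϖ + ϖ′))·⟨u, H_f u⟩` — NO additive term. -/
theorem covJensen_polar_massFree_local
    (hq : ∀ y x, 0 ≤ q y x) (hq1 : ∀ y, ∑ x, q y x = 1) (hW : ∀ y x, (W y x)ᵀ * W y x = 1) (hR : ∀ e, (R e)ᵀ * R e = 1)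
    (hR' : ∀ e', (R' e')ᵀ * R' e' = 1)
    (hQ : ∀ (u : ν × o → ℝ) (y : μ), (fun a => (Q *ᵥ u) (y, a)) = ∑ x, q y x • (W y x *ᵥ fun b => u (x, b)))
    (hwc : 0 ≤ wc)
    (hHc : ∀ v : μ × o → ℝ, v ⬝ᵥ (Hc *ᵥ v) ≤
      wc * ∑ e', ((R' e' *ᵥ fun a => v (tgt' e', a)) - fun a => v (src' e', a)) ⬝ᵥ
        ((R' e' *ᵥ fun a => v (tgt' e', a)) - fun a => v (src' e', a)))
    (hHf : ∀ u : ν × o → ℝ, wf * ∑ e, ((R e *ᵥ fun b => u (tgt e, b)) - fun b => u (src e, b)) ⬝ᵥ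
        ((R e *ᵥ fun b => u (tgt e, b)) - fun b => u (src e, b)) ≤ u ⬝ᵥ (Hf *ᵥ u))
    (hσq : ∀ e' x, q (tgt' e') (σ e' x) = q (src' e') x)
    (hx0 : ∀ e' x, xs e' x 0 = x) (hxℓ : ∀ e' x, xs e' x ℓ = σ e' x)
    (hsrc : ∀ e' x i, i < ℓ → src (γ e' x i) = xs e' x i) (htgt : ∀ e' x i, i < ℓ → tgt (γ e' x i) = xs e' x (i + 1))
    (hT0 : ∀ e' x, T e' x 0 = 1) (hT : ∀ e' x i, i < ℓ → T e' x (i + 1) = T e' x i * R (γ e' x i))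
    (hmult : ∀ e, ∑ e', ∑ x, ∑ i ∈ range ℓ, (if γ e' x i = e then q (src' e') x else 0) ≤ m)
    (hw : wc * ℓ * m ≤ wf)
    (hNdef : ∀ e' x, N e' x = 1 - W (src' e') x * T e' x ℓ * (W (tgt' e') (σ e' x))ᵀ * (R' e')ᵀ)
    (hN : ∀ e' x, q (src' e') x ≠ 0 → ∀ w : o → ℝ, (N e' x *ᵥ w) ⬝ᵥ (N e' x *ᵥ w) ≤ κ ^ 2 * (w ⬝ᵥ w))
    (hsym : ∀ e', (∑ x, q (src' e') x • N e' x)ᵀ = ∑ x, q (src' e') x • N e' x) (hκ : κ ^ 2 < 4)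
    (u : ν × o → ℝ)
    (hP : ∀ y, ∑ x, q y x * (((W y x *ᵥ fun b => u (x, b)) - fun a => (Q *ᵥ u) (y, a)) ⬝ᵥ
        ((W y x *ᵥ fun b => u (x, b)) - fun a => (Q *ᵥ u) (y, a))) ≤ Φ u y)
    (hΦ : wc * ∑ e', Φ u (tgt' e') ≤ ϖ * (u ⬝ᵥ (Hf *ᵥ u))) (hΦ' : wc * ∑ e', Φ u (src' e') ≤ ϖ' * (u ⬝ᵥ (Hf *ᵥ u)))
    {t r : ℝ} (ht : 0 < t) (hr : 0 < r) :
    (Q *ᵥ u) ⬝ᵥ (Hc *ᵥ (Q *ᵥ u)) ≤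
      (1 + t + (1 + t⁻¹) * (1 + r) * ϖ * κ ^ 2 + (1 + t⁻¹) * (1 + r⁻¹) * (3 * κ ^ 2 / (4 - κ ^ 2)) * (1 + ϖ + ϖ')) *
        (u ⬝ᵥ (Hf *ᵥ u)) :=
  (hHc _).trans (sum_coarseDiff_sq_le_polar_local hq hq1 hW hR hR' hQ hwc hHf hσq hx0 hxℓ hsrc htgt hT0 hT hmult hw hNdef hN hsym hκ u hP hΦ hΦ' ht hr)

end End

/-! ## §2 The pointwise defect on the support from the polar letters and the local loop letter -/

section Loops

variable {o ν : Type*} [Fintype o] [DecidableEq o] [Fintype ν]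

omit [DecidableEq o] [Fintype ν] in
/-- **`spread_extend`** — extending a family by a support value keeps the pairwise spread: `q x₀ ≠ 0`, `|(V_b − V_a)w|² ≤ D²|w|²` for `a, b` of nonzero
weight ⟹ the same for all `a, b` for `V̂_x = [q_x ≠ 0]·V_x + [q_x = 0]·V_{x₀}`. [folklore] -/
theorem spread_extend {q : ν → ℝ} {V : ν → Matrix o o ℝ} {D : ℝ} {x₀ : ν} (hx₀ : q x₀ ≠ 0)
    (hDs : ∀ a b, q a ≠ 0 → q b ≠ 0 → ∀ w : o → ℝ, ((V b - V a) *ᵥ w) ⬝ᵥ ((V b - V a) *ᵥ w) ≤ D ^ 2 * (w ⬝ᵥ w)) (a b : ν) (w : o → ℝ) :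
    (((if q b = 0 then V x₀ else V b) - (if q a = 0 then V x₀ else V a)) *ᵥ w) ⬝ᵥ
        (((if q b = 0 then V x₀ else V b) - (if q a = 0 then V x₀ else V a)) *ᵥ w) ≤ D ^ 2 * (w ⬝ᵥ w) := by
  by_cases ha : q a = 0
  · by_cases hb : q b = 0
    · simp only [ha, hb, if_true]; exact hDs x₀ x₀ hx₀ hx₀ w
    · simp only [ha, hb, if_true, if_false]; exact hDs x₀ b hx₀ hb w
  · by_cases hb : q b = 0
    · simp only [ha, hb, if_true, if_false]; exact hDs a x₀ ha hx₀ w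
    · simp only [ha, hb, if_false]; exact hDs a b ha hb w

variable {μ β β' : Type*} [Fintype μ] [Fintype β] [DecidableEq β] [Fintype β']
variable {q : μ → ν → ℝ} {W : μ → ν → Matrix o o ℝ}
variable {R : β → Matrix o o ℝ} {src' tgt' : β' → μ} {R' : β' → Matrix o o ℝ}
variable {σ : β' → ν ≃ ν} {ℓ : ℕ} {γ : β' → ν → ℕ → β} {T : β' → ν → ℕ → Matrix o o ℝ}
variable {N : β' → ν → Matrix o o ℝ} {D : ℝ}

omit [Fintype μ] [Fintype β] [DecidableEq β] [Fintype β'] in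
/-- **`rootDefect_le_of_polar_loops_local` — PART 57's `hN` WITH `κ = 2D` FROM THE LOOP LETTER ON THE SUPPORT** [our proof]: as PART 57
`rootDefect_le_of_polar_loops`, but the closed-loop letter is asked only for pairs of sites of NONZERO weight, and the conclusion `|N(e′,x)w|² ≤ (2D)²|w|²`
is delivered at sites of nonzero weight (PART 57 `rootDefect_le_two_spread` on the family extended off the support by the value at `x`). -/
theorem rootDefect_le_of_polar_loops_local
    (hq : ∀ y x, 0 ≤ q y x) (hq1 : ∀ y, ∑ x, q y x = 1) (hW : ∀ y x, (W y x)ᵀ * W y x = 1) (hR : ∀ e, (R e)ᵀ * R e = 1)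
    (hR' : ∀ e', (R' e')ᵀ * R' e' = 1)
    (hT0 : ∀ e' x, T e' x 0 = 1) (hT : ∀ e' x i, i < ℓ → T e' x (i + 1) = T e' x i * R (γ e' x i))
    (hNdef : ∀ e' x, N e' x = 1 - W (src' e') x * T e' x ℓ * (W (tgt' e') (σ e' x))ᵀ * (R' e')ᵀ)
    (hsym : ∀ e', (∑ x, q (src' e') x • N e' x)ᵀ = ∑ x, q (src' e') x • N e' x)
    (hPpsd : ∀ e' (w : o → ℝ), 0 ≤ w ⬝ᵥ ((∑ x, q (src' e') x • (W (src' e') x * T e' x ℓ * (W (tgt' e') (σ e' x))ᵀ * (R' e')ᵀ)) *ᵥ w))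
    (hloop : ∀ e' x x', q (src' e') x ≠ 0 → q (src' e') x' ≠ 0 → ∀ w : o → ℝ,
      (((W (src' e') x * T e' x ℓ * (W (tgt' e') (σ e' x))ᵀ)ᵀ * (W (src' e') x' * T e' x' ℓ * (W (tgt' e') (σ e' x'))ᵀ) - 1) *ᵥ w) ⬝ᵥ
          (((W (src' e') x * T e' x ℓ * (W (tgt' e') (σ e' x))ᵀ)ᵀ * (W (src' e') x' * T e' x' ℓ * (W (tgt' e') (σ e' x'))ᵀ) - 1) *ᵥ w) ≤
        D ^ 2 * (w ⬝ᵥ w))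
    (e' : β') (x : ν) (hx : q (src' e') x ≠ 0) (w : o → ℝ) :
    (N e' x *ᵥ w) ⬝ᵥ (N e' x *ᵥ w) ≤ (2 * D) ^ 2 * (w ⬝ᵥ w) := by
  classical
  set y := src' e'
  set y' := tgt' e'
  set τ : ν → Matrix o o ℝ := fun a => W y a * T e' a ℓ * (W y' (σ e' a))ᵀ with hτdef
  set V : ν → Matrix o o ℝ := fun a => τ a * (R' e')ᵀ with hVdef
  set Vh : ν → Matrix o o ℝ := fun a => if q y a = 0 then V x else V a with hVhdef
  have hTl : ∀ a, (T e' a ℓ)ᵀ * T e' a ℓ = 1 := fun a =>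
    orthogonal_partialTransport (R := fun i => R (γ e' a i)) (fun i _ => hR _) (hT0 e' a) (fun i hi => hT e' a i hi) ℓ le_rfl
  have hτo : ∀ a, (τ a)ᵀ * τ a = 1 := fun a => orthogonal_mul (orthogonal_mul (hW _ _) (hTl a)) (transpose_orthogonal (hW _ _))
  have hVo : ∀ a, (V a)ᵀ * V a = 1 := fun a => orthogonal_mul (hτo a) (transpose_orthogonal (hR' e'))
  have hVho : ∀ a, (Vh a)ᵀ * Vh a = 1 := fun a => by
    by_cases h : q y a = 0
    · simp only [hVhdef, h, if_true]; exact hVo x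
    · simp only [hVhdef, h, if_false]; exact hVo a
  have hNV : ∀ a, N e' a = 1 - V a := fun a => by rw [hNdef e' a]
  -- the q-weighted mean of the extended family is that of the family
  have hmean : ∑ a, q y a • Vh a = ∑ a, q y a • V a := Finset.sum_congr rfl fun a _ => by
    by_cases h : q y a = 0
    · rw [h, zero_smul, zero_smul]
    · simp only [hVhdef, h, if_false]
  have hPsym : (∑ a, q y a • Vh a)ᵀ = ∑ a, q y a • Vh a := by
    have hs := hsym e'
    simp_rw [hNV, smul_sub, Finset.sum_sub_distrib, ← Finset.sum_smul, hq1, one_smul, transpose_sub, transpose_one] at hs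
    rw [hmean]
    exact sub_right_injective hs
  have hPpsd' : ∀ v : o → ℝ, 0 ≤ v ⬝ᵥ ((∑ a, q y a • Vh a) *ᵥ v) := fun v => by rw [hmean]; exact hPpsd e' v
  -- the spread on the support from the loop letter, extended
  have hDs : ∀ a b, q y a ≠ 0 → q y b ≠ 0 → ∀ v : o → ℝ, ((V b - V a) *ᵥ v) ⬝ᵥ ((V b - V a) *ᵥ v) ≤ D ^ 2 * (v ⬝ᵥ v) :=
    fun a b ha hb v => by
      have e := spread_eq_loopDefect (τ := τ a) (τ' := τ b) (R' := R' e') (hτo a) v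
      simp only [hVdef]
      rw [e]
      refine (hloop e' a b ha hb _).trans (le_of_eq ?_)
      rw [self_of_orthogonal (transpose_orthogonal (hR' e'))]
  have hD : ∀ a b (v : o → ℝ), ((Vh b - Vh a) *ᵥ v) ⬝ᵥ ((Vh b - Vh a) *ᵥ v) ≤ D ^ 2 * (v ⬝ᵥ v) := fun a b v => by
    simp only [hVhdef]
    exact spread_extend (q := q y) (V := V) hx hDs a b v
  have h := rootDefect_le_two_spread (hq y) (hq1 y) hVho hPsym hPpsd' hD x w
  have hVhx : Vh x = V x := by simp only [hVhdef, hx, if_false]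
  rwa [hVhx, ← hNV] at h

end Loops

/-! ## §3 The loop form and the convention-free form of the `δ = 0` END, support-local -/

section LoopEnd

variable {o μ ν β β' : Type*} [Fintype o] [DecidableEq o] [Fintype μ] [Fintype ν] [Fintype β] [DecidableEq β] [Fintype β']
variable {q : μ → ν → ℝ} {W : μ → ν → Matrix o o ℝ} {Q : Matrix (μ × o) (ν × o) ℝ}
variable {src tgt : β → ν} {R : β → Matrix o o ℝ} {src' tgt' : β' → μ} {R' : β' → Matrix o o ℝ}
variable {Hf : Matrix (ν × o) (ν × o) ℝ} {Hc : Matrix (μ × o) (μ × o) ℝ} {wf wc : ℝ}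
variable {σ : β' → ν ≃ ν} {ℓ : ℕ} {xs : β' → ν → ℕ → ν} {γ : β' → ν → ℕ → β} {T : β' → ν → ℕ → Matrix o o ℝ} {m : ℝ}
variable {N : β' → ν → Matrix o o ℝ} {Φ : (ν × o → ℝ) → μ → ℝ} {ϖ ϖ' D : ℝ}

/-- **`covJensen_polar_massFree_of_loops_local` — PART 57's `δ = 0` END WITH THE LOOP LETTER ON THE SUPPORT** [our proof]: the hypotheses of PART 57
`covJensen_polar_massFree_of_loops` with `hloop` asked only for pairs of sites of nonzero weight.  For all `t, r > 0`:
`⟨Qu, H_cQu⟩ ≤ (1 + t + (1+t⁻¹)(1+r)ϖ(2D)² + (1+t⁻¹)(1+r⁻¹)·3(2D)²(1 + ϖ + ϖ′)∕(4 − (2D)²))·⟨u, H_f u⟩`. -/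
theorem covJensen_polar_massFree_of_loops_local
    (hq : ∀ y x, 0 ≤ q y x) (hq1 : ∀ y, ∑ x, q y x = 1) (hW : ∀ y x, (W y x)ᵀ * W y x = 1) (hR : ∀ e, (R e)ᵀ * R e = 1)
    (hR' : ∀ e', (R' e')ᵀ * R' e' = 1)
    (hQ : ∀ (u : ν × o → ℝ) (y : μ), (fun a => (Q *ᵥ u) (y, a)) = ∑ x, q y x • (W y x *ᵥ fun b => u (x, b)))
    (hwc : 0 ≤ wc)
    (hHc : ∀ v : μ × o → ℝ, v ⬝ᵥ (Hc *ᵥ v) ≤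
      wc * ∑ e', ((R' e' *ᵥ fun a => v (tgt' e', a)) - fun a => v (src' e', a)) ⬝ᵥ
        ((R' e' *ᵥ fun a => v (tgt' e', a)) - fun a => v (src' e', a)))
    (hHf : ∀ u : ν × o → ℝ, wf * ∑ e, ((R e *ᵥ fun b => u (tgt e, b)) - fun b => u (src e, b)) ⬝ᵥ
        ((R e *ᵥ fun b => u (tgt e, b)) - fun b => u (src e, b)) ≤ u ⬝ᵥ (Hf *ᵥ u))
    (hσq : ∀ e' x, q (tgt' e') (σ e' x) = q (src' e') x)
    (hx0 : ∀ e' x, xs e' x 0 = x) (hxℓ : ∀ e' x, xs e' x ℓ = σ e' x)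
    (hsrc : ∀ e' x i, i < ℓ → src (γ e' x i) = xs e' x i) (htgt : ∀ e' x i, i < ℓ → tgt (γ e' x i) = xs e' x (i + 1))
    (hT0 : ∀ e' x, T e' x 0 = 1) (hT : ∀ e' x i, i < ℓ → T e' x (i + 1) = T e' x i * R (γ e' x i))
    (hmult : ∀ e, ∑ e', ∑ x, ∑ i ∈ range ℓ, (if γ e' x i = e then q (src' e') x else 0) ≤ m)
    (hw : wc * ℓ * m ≤ wf)
    (hNdef : ∀ e' x, N e' x = 1 - W (src' e') x * T e' x ℓ * (W (tgt' e') (σ e' x))ᵀ * (R' e')ᵀ)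
    (hsym : ∀ e', (∑ x, q (src' e') x • N e' x)ᵀ = ∑ x, q (src' e') x • N e' x)
    (hPpsd : ∀ e' (w : o → ℝ), 0 ≤ w ⬝ᵥ ((∑ x, q (src' e') x • (W (src' e') x * T e' x ℓ * (W (tgt' e') (σ e' x))ᵀ * (R' e')ᵀ)) *ᵥ w))
    (hloop : ∀ e' x x', q (src' e') x ≠ 0 → q (src' e') x' ≠ 0 → ∀ w : o → ℝ,
      (((W (src' e') x * T e' x ℓ * (W (tgt' e') (σ e' x))ᵀ)ᵀ * (W (src' e') x' * T e' x' ℓ * (W (tgt' e') (σ e' x'))ᵀ) - 1) *ᵥ w) ⬝ᵥ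
          (((W (src' e') x * T e' x ℓ * (W (tgt' e') (σ e' x))ᵀ)ᵀ * (W (src' e') x' * T e' x' ℓ * (W (tgt' e') (σ e' x'))ᵀ) - 1) *ᵥ w) ≤
        D ^ 2 * (w ⬝ᵥ w))
    (hD1 : D < 1) (hD0 : 0 ≤ D)
    (u : ν × o → ℝ)
    (hP : ∀ y, ∑ x, q y x * (((W y x *ᵥ fun b => u (x, b)) - fun a => (Q *ᵥ u) (y, a)) ⬝ᵥ
        ((W y x *ᵥ fun b => u (x, b)) - fun a => (Q *ᵥ u) (y, a))) ≤ Φ u y)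
    (hΦ : wc * ∑ e', Φ u (tgt' e') ≤ ϖ * (u ⬝ᵥ (Hf *ᵥ u))) (hΦ' : wc * ∑ e', Φ u (src' e') ≤ ϖ' * (u ⬝ᵥ (Hf *ᵥ u)))
    {t r : ℝ} (ht : 0 < t) (hr : 0 < r) :
    (Q *ᵥ u) ⬝ᵥ (Hc *ᵥ (Q *ᵥ u)) ≤
      (1 + t + (1 + t⁻¹) * (1 + r) * ϖ * (2 * D) ^ 2 +
          (1 + t⁻¹) * (1 + r⁻¹) * (3 * (2 * D) ^ 2 / (4 - (2 * D) ^ 2)) * (1 + ϖ + ϖ')) * (u ⬝ᵥ (Hf *ᵥ u)) := by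
  have hN : ∀ e' x, q (src' e') x ≠ 0 → ∀ w : o → ℝ, (N e' x *ᵥ w) ⬝ᵥ (N e' x *ᵥ w) ≤ (2 * D) ^ 2 * (w ⬝ᵥ w) := fun e' x hx w =>
    rootDefect_le_of_polar_loops_local hq hq1 hW hR hR' hT0 hT hNdef hsym hPpsd hloop e' x hx w
  have hκ : (2 * D) ^ 2 < 4 := by nlinarith
  exact covJensen_polar_massFree_local hq hq1 hW hR hR' hQ hwc hHc hHf hσq hx0 hxℓ hsrc htgt hT0 hT hmult hw hNdef hN hsym hκ u hP hΦ hΦ' ht hr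

/-- **`exists_polarLink_covJensen_massFree_local` — THE CONVENTION-FREE `δ = 0` END FROM FINE DATA AND THE LOCAL LOOP LETTER** [our proof; PART 58
`exists_polarLink` + `covJensen_polar_massFree_of_loops_local`]: as PART 58 `exists_polarLink_covJensen_massFree`, with the closed-loop letter asked only
for pairs of sites of nonzero weight.  THERE ARE orthogonal coarse links `R′` (the polar links) such that for every `w_c ≥ 0` with `w_c·ℓ·m ≤ w_f`, every
coarse form `H_c ≤ w_c·Σ|R′v(tgt′) − v(src′)|²`, every `u` with Poincaré data and all `t, r > 0`:
`⟨Qu, H_cQu⟩ ≤ (1 + t + (1+t⁻¹)(1+r)ϖ(2D)² + (1+t⁻¹)(1+r⁻¹)·3(2D)²(1 + ϖ + ϖ′)∕(4 − (2D)²))·⟨u, H_f u⟩`. -/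
theorem exists_polarLink_covJensen_massFree_local
    (hq : ∀ y x, 0 ≤ q y x) (hq1 : ∀ y, ∑ x, q y x = 1) (hW : ∀ y x, (W y x)ᵀ * W y x = 1) (hR : ∀ e, (R e)ᵀ * R e = 1)
    (hQ : ∀ (u : ν × o → ℝ) (y : μ), (fun a => (Q *ᵥ u) (y, a)) = ∑ x, q y x • (W y x *ᵥ fun b => u (x, b)))
    (hHf : ∀ u : ν × o → ℝ, wf * ∑ e, ((R e *ᵥ fun b => u (tgt e, b)) - fun b => u (src e, b)) ⬝ᵥ
        ((R e *ᵥ fun b => u (tgt e, b)) - fun b => u (src e, b)) ≤ u ⬝ᵥ (Hf *ᵥ u))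
    (hσq : ∀ e' x, q (tgt' e') (σ e' x) = q (src' e') x)
    (hx0 : ∀ e' x, xs e' x 0 = x) (hxℓ : ∀ e' x, xs e' x ℓ = σ e' x)
    (hsrc : ∀ e' x i, i < ℓ → src (γ e' x i) = xs e' x i) (htgt : ∀ e' x i, i < ℓ → tgt (γ e' x i) = xs e' x (i + 1))
    (hT0 : ∀ e' x, T e' x 0 = 1) (hT : ∀ e' x i, i < ℓ → T e' x (i + 1) = T e' x i * R (γ e' x i))
    (hmult : ∀ e, ∑ e', ∑ x, ∑ i ∈ range ℓ, (if γ e' x i = e then q (src' e') x else 0) ≤ m)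
    (hloop : ∀ e' x x', q (src' e') x ≠ 0 → q (src' e') x' ≠ 0 → ∀ w : o → ℝ,
      (((W (src' e') x * T e' x ℓ * (W (tgt' e') (σ e' x))ᵀ)ᵀ * (W (src' e') x' * T e' x' ℓ * (W (tgt' e') (σ e' x'))ᵀ) - 1) *ᵥ w) ⬝ᵥ
          (((W (src' e') x * T e' x ℓ * (W (tgt' e') (σ e' x))ᵀ)ᵀ * (W (src' e') x' * T e' x' ℓ * (W (tgt' e') (σ e' x'))ᵀ) - 1) *ᵥ w) ≤
        D ^ 2 * (w ⬝ᵥ w))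
    (hD0 : 0 ≤ D) (hD1 : D < 1) :
    ∃ R' : β' → Matrix o o ℝ, (∀ e', (R' e')ᵀ * R' e' = 1) ∧
      ∀ (wc : ℝ) (_hwc : 0 ≤ wc) (_hw : wc * ℓ * m ≤ wf) (Hc : Matrix (μ × o) (μ × o) ℝ)
        (_hHc : ∀ v : μ × o → ℝ, v ⬝ᵥ (Hc *ᵥ v) ≤
          wc * ∑ e', ((R' e' *ᵥ fun a => v (tgt' e', a)) - fun a => v (src' e', a)) ⬝ᵥ
            ((R' e' *ᵥ fun a => v (tgt' e', a)) - fun a => v (src' e', a)))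
        (u : ν × o → ℝ) (Φ : (ν × o → ℝ) → μ → ℝ) (ϖ ϖ' : ℝ)
        (_hP : ∀ y, ∑ x, q y x * (((W y x *ᵥ fun b => u (x, b)) - fun a => (Q *ᵥ u) (y, a)) ⬝ᵥ
          ((W y x *ᵥ fun b => u (x, b)) - fun a => (Q *ᵥ u) (y, a))) ≤ Φ u y)
        (_hΦ : wc * ∑ e', Φ u (tgt' e') ≤ ϖ * (u ⬝ᵥ (Hf *ᵥ u))) (_hΦ' : wc * ∑ e', Φ u (src' e') ≤ ϖ' * (u ⬝ᵥ (Hf *ᵥ u)))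
        (t r : ℝ) (_ht : 0 < t) (_hr : 0 < r),
        (Q *ᵥ u) ⬝ᵥ (Hc *ᵥ (Q *ᵥ u)) ≤
          (1 + t + (1 + t⁻¹) * (1 + r) * ϖ * (2 * D) ^ 2 +
              (1 + t⁻¹) * (1 + r⁻¹) * (3 * (2 * D) ^ 2 / (4 - (2 * D) ^ 2)) * (1 + ϖ + ϖ')) * (u ⬝ᵥ (Hf *ᵥ u)) := by
  obtain ⟨R', hR'o, hsym, hPpsd⟩ := exists_polarLink (W := W) (T := T) (σ := σ) (src' := src') (tgt' := tgt') (ℓ := ℓ) hq hq1 hloop hD0 hD1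
  refine ⟨R', hR'o, ?_⟩
  intro wc hwc hw Hc hHc u Φ ϖ ϖ' hP hΦ hΦ' t r ht hr
  exact covJensen_polar_massFree_of_loops_local (N := fun e' x => 1 - W (src' e') x * T e' x ℓ * (W (tgt' e') (σ e' x))ᵀ * (R' e')ᵀ)
    hq hq1 hW hR hR'o hQ hwc hHc hHf hσq hx0 hxℓ hsrc htgt hT0 hT hmult hw (fun _ _ => rfl) hsym hPpsd hloop hD1 hD0 u hP hΦ hΦ' ht hr

end LoopEnd

end Summit.QuantumFields.BalabanUV.Beta.GAN24.DerivativeRateTransferJensenMassFreeLocalEnd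

end
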